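import Literature.Analysis.SegalBargmann.SchwartzBargmannIntertwining
import HarnessLib

/-!
# Degree-one `K`-types of the Schrödinger model: the family `a ↦ Σ aᵢ h_{eᵢ}` under `μ₀(U)` and under the compact dual pair (Folland 1989, Prop. (4.39); Kashiwara–Vergne 1978)

Topic `Analysis/SegalBargmann`; namespace `Literature.Analysis.SegalBargmann`.  The tree identifies the Heisenberg-covariant
compact group on `𝓢(ℝ^σ)` with Folland's block action `μ₀(U) = B⁻¹ ν₀(U) B` (`unitaryOpPi`, `unitaryOpPi_hermitePi`:
`μ₀(U) h_β = Σ_{|α| ≤ |β|} uKernel U α β • h_α`) and, for the compact dual pair `(U(P)×U(Q)) × (U(R)×U(S))` with block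
datum `dualPairι k = diag(conj(a⊗c), conj(b⊗d), a⊗d, b⊗c)`, computes the torus WEIGHTS of the Hermite functions
(`SchwartzDualPairTorus`).  This file computes the degree-ONE block EXPLICITLY, vector-valued:

* `unitaryOpPi_hermitePi_single`: Folland's `ν(U)F = F ∘ U⁻¹` (Prop. (4.39)) read on `𝓢` through the tree's Bargmann
  dictionary `unitaryOpPi_binvPi : μ₀(U) B⁻¹F = B⁻¹ (linSubst (star U) F)` (`SchwartzBargmannIntertwining`) on the
  degree-one monomials `ζ_{eᵢ} = √π zᵢ` (`linSubst_zeta_single`): `μ₀(U) h_{eᵢ} = Σⱼ (U*)ᵢⱼ h_{eⱼ}` in `𝓢(ℝ^σ)`; the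
  `L²` form `schrodingerU_hermiteL2_single` and the matrix entries `uKernel_single_single : uKernel U eⱼ eᵢ = (U*)ᵢⱼ`;
* `degOne : (σ → ℂ) →ₗ[ℂ] 𝓢(ℝ^σ)`, `a ↦ Σᵢ aᵢ h_{eᵢ}` — the degree-one family — with
  `unitaryOpPi_degOne : μ₀(U) (degOne a) = degOne (Ū a)` (`Ū = U.map star`, the CONJUGATE-standard representation:
  Folland's `F ↦ F ∘ U⁻¹` on linear forms), `degOne_injective`;
* the compact dual pair: `dualPairι_map_star_mulVec` (the conjugate of the block datum on a block vector) and
  `unitaryOpPi_dualPairι_degOne`: on `degOne (a ⊕ b ⊕ c ⊕ d)` the element `k = ((A,B),(C,D))` acts by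
  `(A⊗C) a ⊕ (B⊗D) b ⊕ conj(A⊗D) c ⊕ conj(B⊗C) d` — the two same-sign ("holomorphic") blocks carry the STANDARD
  Kronecker representations `std_P ⊠ std_R`, `std_Q ⊠ std_S` (this is what the conjugation of those blocks in `dualPairι`
  is for), the mixed blocks the conjugate ones; the holomorphic `V⁺ ⊗ W⁺` family `degOnePR : (P × R → ℂ) →ₗ[ℂ] 𝓢` with
  `unitaryOpPi_dualPairι_degOnePR : μ₀(dualPairι k) (degOnePR a) = degOnePR ((A ⊗ₖ C) *ᵥ a)`, and for a rank-one second
  member (`R = Unit`) the family `degOneP : (P → ℂ) →ₗ[ℂ] 𝓢` on which `k` acts by `C • (A *ᵥ a)`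
  (`unitaryOpPi_dualPairι_degOneP`).

These are the degree-`(1,0)` pluriharmonics of Kashiwara–Vergne (every polynomial of degree one is harmonic) read in
the Schrödinger model; combined with the rigidity `ωS k = vacCoeff • μ₀(ι k)` of `SchwartzUnitaryIdentification` (and the constructed
`compactWeilRep` / `dualPairWeilRep` of `SchwartzCompactWeilRep`) they give the `K × K′`-type of the degree-one vectors of ANY covariant realisation
(`IsRhoCovariantS.apply_degOnePR_dualPair`, `dualPairWeilRep_degOnePR`).  Everything is a composition of landed tree theorems; no cited statement is
used as a hypothesis.

## References

* [Folland1989] G. B. Folland, *Harmonic Analysis in Phase Space*, Princeton UP (1989), Prop. (4.39) ("ν(𝒜)F(z) =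
  (det^{-1/2} P) F(P⁻¹ z)"), Ch. 4 §5 ("U ∈ U(n), F ∈ 𝓟_k ⟹ F ∘ U⁻¹ ∈ 𝓟_k"), Thm (1.63). [cite: Folland1989, Prop (4.39)]
* M. Kashiwara, M. Vergne, *On the Segal–Shale–Weil representations and harmonic polynomials*, Invent. Math. 44 (1978)
  1–47, (5.1)–(5.5) (the `K×K′`-structure of the Fock model of a unitary dual pair; degree one is entirely harmonic).

## Provenance

LEAN-IN-TREE rule (2026-08-18), pub-hodgecm model-construction sub-cell, seat mc-theta-2 gen 4: tree half of the
archimedean `K`-type clause (W-K∞′) `harm` of `ArchKTypeData` (the degree-one harmonic family is `K_∞`-equivariant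
of type `χ ⊗ std`).
-/

set_option autoImplicit false

noncomputable section

open MeasureTheory Complex SchwartzMap Filter Topology MvPolynomial
open scoped InnerProductSpace ComplexConjugate Real BigOperators Kronecker Matrix

namespace Literature.Analysis.SegalBargmann

variable {σ : Type*} [Fintype σ] [DecidableEq σ]

local notation "L2R" σ => Lp ℂ 2 (volume : Measure (σ → ℝ))
local notation "SR" σ => SchwartzMap (σ → ℝ) ℂ

/-! ## §1  Degree one: `μ₀(U) h_{eᵢ} = Σⱼ (U*)ᵢⱼ h_{eⱼ}` (the Bargmann dictionary of `SchwartzBargmannIntertwining` on `ζ_{eᵢ}`) -/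

section DegreeOne

omit [DecidableEq σ] in
/-- `|eᵢ| = 1`. [folklore] -/
theorem mdeg_single_one (i : σ) : mdeg (Finsupp.single i 1) = 1 := by
  classical
  simp [mdeg, Finsupp.single_apply]

omit [DecidableEq σ] in
/-- `eᵢ! = 1`. [folklore] -/
theorem mfact_single_one (i : σ) : mfact (Finsupp.single i 1) = 1 := by
  classical
  rw [mfact]
  refine Finset.prod_eq_one fun j _ => ?_
  rcases eq_or_ne j i with rfl | h
  · rw [Finsupp.single_eq_same, Nat.factorial_one]
  · rw [Finsupp.single_eq_of_ne h, Nat.factorial_zero]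

omit [DecidableEq σ] in
/-- Folland's normalisation in degree one: `√(π^{|eᵢ|}/eᵢ!) = √π`. [folklore] -/
theorem hcoef_single_one (i : σ) : hcoef (Finsupp.single i 1) = Real.sqrt π := by
  rw [hcoef, mdeg_single_one, mfact_single_one, pow_one, Nat.cast_one, div_one]

omit [DecidableEq σ] in
/-- `ζ_{eᵢ} = √π · zᵢ`. [folklore] -/
theorem zeta_single (i : σ) : zeta (Finsupp.single i 1) = ((Real.sqrt π : ℝ) : ℂ) • (X i : MvPolynomial σ ℂ) := by
  rw [zeta, hcoef_single_one, X]

omit [DecidableEq σ] in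
/-- **The linear substitution on the degree-one basis** (`FockUnitaryAction.linSubst_X`, equal normalisations `√π`):
`linSubst M ζ_{eᵢ} = Σⱼ Mᵢⱼ ζ_{eⱼ}`. [folklore] -/
theorem linSubst_zeta_single (M : Matrix σ σ ℂ) (i : σ) :
    linSubst M (zeta (Finsupp.single i 1)) = ∑ j, M i j • zeta (Finsupp.single j 1) := by
  simp_rw [zeta_single]
  rw [map_smul, linSubst_X, Finset.smul_sum]
  refine Finset.sum_congr rfl fun j _ => ?_
  rw [MvPolynomial.C_mul', smul_comm]

/-- `B⁻¹` of a finite linear combination of the `ζ_{eⱼ}`. [folklore] -/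
theorem binvPi_sum_smul_zeta_single (c : σ → ℂ) :
    binvPi (∑ j, c j • zeta (Finsupp.single j 1)) = (∑ j, c j • hermitePi (Finsupp.single j 1) : SR σ) := by
  change binvPiₗ (∑ j, c j • zeta (Finsupp.single j 1)) = _
  rw [map_sum]
  refine Finset.sum_congr rfl fun j _ => ?_
  rw [map_smul]
  rfl

/-- **Degree one in `𝓢(ℝ^σ)`** [Folland Prop (4.39): `ν(U)F = F ∘ U⁻¹`, through the tree's `unitaryOpPi_binvPi`]:
`μ₀(U) h_{eᵢ} = Σⱼ (U*)ᵢⱼ h_{eⱼ}` — the conjugate-transpose `star U` acting on the index (sign convention: `star`, as in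
`linSubst (star U)` / `invSubst`). [cite: Folland1989, Prop (4.39)] -/
theorem unitaryOpPi_hermitePi_single (U : Matrix.unitaryGroup σ ℂ) (i : σ) :
    unitaryOpPi U (hermitePi (Finsupp.single i 1)) =
      ∑ j, (star (U : Matrix σ σ ℂ)) i j • hermitePi (Finsupp.single j 1) := by
  rw [← binvPi_zeta, unitaryOpPi_binvPi, linSubst_zeta_single, binvPi_sum_smul_zeta_single]

/-- The same in `L²(ℝ^σ)`: `μ₀(U) h_{eᵢ} = Σⱼ (U*)ᵢⱼ h_{eⱼ}`. [cite: Folland1989, Prop (4.39)] -/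
theorem schrodingerU_hermiteL2_single (U : Matrix.unitaryGroup σ ℂ) (i : σ) :
    schrodingerU U (hermiteL2 (Finsupp.single i 1) : L2R σ) =
      ∑ j, (star (U : Matrix σ σ ℂ)) i j • hermiteL2 (Finsupp.single j 1) := by
  rw [← toL2_hermitePi, ← toL2_unitaryOpPi, unitaryOpPi_hermitePi_single, map_sum]
  simp_rw [map_smul, toL2_hermitePi]

/-- **The degree-one block of the Hermite-basis matrix**: `uKernel U eⱼ eᵢ = ⟪h_{eⱼ}, μ₀(U) h_{eᵢ}⟫ = (U*)ᵢⱼ`.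
[cite: Folland1989, Prop (4.39)] -/
theorem uKernel_single_single (U : Matrix.unitaryGroup σ ℂ) (j i : σ) :
    uKernel U (Finsupp.single j 1) (Finsupp.single i 1) = (star (U : Matrix σ σ ℂ)) i j := by
  rw [uKernel, schrodingerU_hermiteL2_single, inner_sum]
  simp_rw [inner_smul_right, orthonormal_iff_ite.mp orthonormal_hermiteL2, Finsupp.single_left_inj one_ne_zero,
    mul_ite, mul_one, mul_zero]
  rw [Finset.sum_ite_eq, if_pos (Finset.mem_univ j)]

/-- The same entry as a conjugate: `uKernel U eⱼ eᵢ = conj Uⱼᵢ`. [cite: Folland1989, Prop (4.39)] -/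
theorem uKernel_single_single' (U : Matrix.unitaryGroup σ ℂ) (j i : σ) :
    uKernel U (Finsupp.single j 1) (Finsupp.single i 1) = star ((U : Matrix σ σ ℂ) j i) := by
  rw [uKernel_single_single, Matrix.star_apply]

end DegreeOne

/-! ## §2  The family `degOne : (σ → ℂ) →ₗ[ℂ] 𝓢(ℝ^σ)` and its `U(σ)`-type -/

section Schwartz

/-- **The degree-one family** `degOne a := Σᵢ aᵢ • h_{eᵢ} ∈ 𝓢(ℝ^σ)` (the linear forms `Σ aᵢ zᵢ` of the Fock model times
the Gaussian, read through `B⁻¹`). [cite: Folland1989, Prop (4.39)] -/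
def degOne : (σ → ℂ) →ₗ[ℂ] SR σ where
  toFun a := ∑ i, a i • hermitePi (Finsupp.single i 1)
  map_add' a b := by
    simp only [Pi.add_apply, add_smul, Finset.sum_add_distrib]
  map_smul' c a := by
    simp only [Pi.smul_apply, smul_eq_mul, mul_smul, Finset.smul_sum, RingHom.id_apply]

/-- Unfolding. [folklore] -/
theorem degOne_apply (a : σ → ℂ) : degOne a = ∑ i, a i • hermitePi (Finsupp.single i 1) := rfl

/-- On the coordinate vectors: `degOne δᵢ = h_{eᵢ}`. [folklore] -/
theorem degOne_pi_single (i : σ) : degOne (Pi.single i 1 : σ → ℂ) = hermitePi (Finsupp.single i 1) := by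
  rw [degOne_apply, Finset.sum_eq_single i (fun j _ hj => by rw [Pi.single_eq_of_ne hj, zero_smul])
    (fun h => absurd (Finset.mem_univ i) h), Pi.single_eq_same, one_smul]

/-- In `L²`: `toL2 (degOne a) = Σᵢ aᵢ • h_{eᵢ}`. [folklore] -/
theorem toL2_degOne (a : σ → ℂ) : toL2 (degOne a) = ∑ i, a i • (hermiteL2 (Finsupp.single i 1) : L2R σ) := by
  rw [degOne_apply, map_sum]
  simp_rw [map_smul, toL2_hermitePi]

/-- The coordinates are recovered as Hermite coefficients: `⟪h_{eⱼ}, degOne a⟫ = aⱼ`. [folklore] -/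
theorem inner_hermiteL2_toL2_degOne (a : σ → ℂ) (j : σ) :
    ⟪(hermiteL2 (Finsupp.single j 1) : L2R σ), toL2 (degOne a)⟫_ℂ = a j := by
  rw [toL2_degOne, inner_sum]
  simp_rw [inner_smul_right, orthonormal_iff_ite.mp orthonormal_hermiteL2, Finsupp.single_left_inj one_ne_zero,
    mul_ite, mul_one, mul_zero]
  rw [Finset.sum_ite_eq, if_pos (Finset.mem_univ j)]

/-- **`degOne` is injective** (the `h_{eᵢ}` are orthonormal). [folklore] -/
theorem degOne_injective : Function.Injective (degOne (σ := σ)) := by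
  intro a b h
  funext j
  rw [← inner_hermiteL2_toL2_degOne a j, ← inner_hermiteL2_toL2_degOne b j, h]

/-- **The degree-one `K`-type** [Folland Prop (4.39), Ch. 4 §5]: `μ₀(U) (degOne a) = degOne (Ū a)` with `Ū = U.map star`
the entrywise conjugate — the family `degOne` carries the conjugate-standard representation of `U(σ)` (Folland's
`F ↦ F ∘ U⁻¹` on the linear forms). [cite: Folland1989, Prop (4.39)] -/
theorem unitaryOpPi_degOne (U : Matrix.unitaryGroup σ ℂ) (a : σ → ℂ) :
    unitaryOpPi U (degOne a) = degOne ((U : Matrix σ σ ℂ).map star *ᵥ a) := by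
  rw [degOne_apply, degOne_apply, map_sum]
  simp_rw [map_smul, unitaryOpPi_hermitePi_single, Finset.smul_sum, smul_smul]
  rw [Finset.sum_comm]
  refine Finset.sum_congr rfl fun j _ => ?_
  rw [← Finset.sum_smul]
  congr 1
  simp only [Matrix.mulVec, dotProduct, Matrix.map_apply, Matrix.star_apply]
  exact Finset.sum_congr rfl fun i _ => mul_comm _ _

/-- The same with the tree's conjugation homomorphism `conjU`. [cite: Folland1989, Prop (4.39)] -/
theorem unitaryOpPi_degOne_conjU (U : Matrix.unitaryGroup σ ℂ) (a : σ → ℂ) :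
    unitaryOpPi U (degOne a) = degOne (((conjU U : Matrix.unitaryGroup σ ℂ) : Matrix σ σ ℂ) *ᵥ a) := by
  rw [coe_conjU, unitaryOpPi_degOne]

/-- Conversely the conjugated group element acts by the STANDARD representation: `μ₀(Ū) (degOne a) = degOne (U a)`.
[cite: Folland1989, Prop (4.39)] -/
theorem unitaryOpPi_conjU_degOne (U : Matrix.unitaryGroup σ ℂ) (a : σ → ℂ) :
    unitaryOpPi (conjU U) (degOne a) = degOne ((U : Matrix σ σ ℂ) *ᵥ a) := by
  rw [unitaryOpPi_degOne, coe_conjU, Matrix.map_map]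
  have hss : (star ∘ star : ℂ → ℂ) = id := funext fun z => star_star z
  rw [hss, Matrix.map_id]

end Schwartz

/-! ## §3  The compact dual pair `(U(P)×U(Q)) × (U(R)×U(S))` on the degree-one vectors -/

section DualPair

variable {P Q R S : Type*} [Fintype P] [DecidableEq P] [Fintype Q] [DecidableEq Q] [Fintype R] [DecidableEq R]
  [Fintype S] [DecidableEq S]

local notation "SD" => SchwartzMap (DPIdx P Q R S → ℝ) ℂ

omit [DecidableEq P] [DecidableEq Q] [DecidableEq R] [DecidableEq S] in
/-- Entrywise conjugation commutes with the Kronecker product. [folklore] -/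
theorem kronecker_map_star {m n : Type*} (A : Matrix m m ℂ) (B : Matrix n n ℂ) :
    (A ⊗ₖ B).map star = A.map star ⊗ₖ B.map star := by
  ext ⟨i, k⟩ ⟨j, l⟩
  simp only [Matrix.map_apply, Matrix.kroneckerMap_apply, star_mul']

/-- **The conjugate of the block datum**: `conj(dualPairι k) = diag(A⊗C, B⊗D, conj(A⊗D), conj(B⊗C))`. [folklore] -/
theorem dualPairι_map_star (k : DPK P Q R S) :
    ((dualPairι k : Matrix.unitaryGroup (DPIdx P Q R S) ℂ) : Matrix (DPIdx P Q R S) (DPIdx P Q R S) ℂ).map star =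
      Matrix.fromBlocks
        (Matrix.fromBlocks ((k.1.1 : Matrix P P ℂ) ⊗ₖ (k.2.1 : Matrix R R ℂ)) 0 0
          ((k.1.2 : Matrix Q Q ℂ) ⊗ₖ (k.2.2 : Matrix S S ℂ))) 0 0
        (Matrix.fromBlocks (((k.1.1 : Matrix P P ℂ) ⊗ₖ (k.2.2 : Matrix S S ℂ)).map star) 0 0
          (((k.1.2 : Matrix Q Q ℂ) ⊗ₖ (k.2.1 : Matrix R R ℂ)).map star)) := by
  rw [coe_dualPairι]
  ext i j
  rcases i with ((i | i) | (i | i)) <;> rcases j with ((j | j) | (j | j)) <;>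
    simp only [Matrix.map_apply, Matrix.fromBlocks_apply₁₁, Matrix.fromBlocks_apply₁₂, Matrix.fromBlocks_apply₂₁,
      Matrix.fromBlocks_apply₂₂, Matrix.zero_apply, star_zero, star_star]

/-- **The conjugate of the block datum on a block vector**:
`conj(dualPairι k) · (a ⊕ b ⊕ c ⊕ d) = (A⊗C) a ⊕ (B⊗D) b ⊕ conj(A⊗D) c ⊕ conj(B⊗C) d`. [folklore] -/
theorem dualPairι_map_star_mulVec (k : DPK P Q R S) (a : P × R → ℂ) (b : Q × S → ℂ) (c : P × S → ℂ)
    (d : Q × R → ℂ) :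
    ((dualPairι k : Matrix.unitaryGroup (DPIdx P Q R S) ℂ) : Matrix (DPIdx P Q R S) (DPIdx P Q R S) ℂ).map star *ᵥ
        Sum.elim (Sum.elim a b) (Sum.elim c d) =
      Sum.elim
        (Sum.elim (((k.1.1 : Matrix P P ℂ) ⊗ₖ (k.2.1 : Matrix R R ℂ)) *ᵥ a)
          (((k.1.2 : Matrix Q Q ℂ) ⊗ₖ (k.2.2 : Matrix S S ℂ)) *ᵥ b))
        (Sum.elim ((((k.1.1 : Matrix P P ℂ) ⊗ₖ (k.2.2 : Matrix S S ℂ)).map star) *ᵥ c)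
          ((((k.1.2 : Matrix Q Q ℂ) ⊗ₖ (k.2.1 : Matrix R R ℂ)).map star) *ᵥ d)) := by
  simp only [dualPairι_map_star, Matrix.fromBlocks_mulVec, Sum.elim_comp_inl, Sum.elim_comp_inr, Matrix.zero_mulVec,
    add_zero, zero_add]

/-- **The compact dual pair on the degree-one vectors** [Folland Prop (4.39) through `dualPairι`]: on
`degOne (a ⊕ b ⊕ c ⊕ d)` the element `k = ((A,B),(C,D))` acts by `(A⊗C) a ⊕ (B⊗D) b ⊕ conj(A⊗D) c ⊕ conj(B⊗C) d` — the
same-sign blocks carry the standard Kronecker representations, the mixed blocks the conjugate ones.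
[cite: Folland1989, Prop (4.39)] -/
theorem unitaryOpPi_dualPairι_degOne (k : DPK P Q R S) (a : P × R → ℂ) (b : Q × S → ℂ) (c : P × S → ℂ)
    (d : Q × R → ℂ) :
    unitaryOpPi (dualPairι k) (degOne (Sum.elim (Sum.elim a b) (Sum.elim c d)) : SD) =
      degOne (Sum.elim
        (Sum.elim (((k.1.1 : Matrix P P ℂ) ⊗ₖ (k.2.1 : Matrix R R ℂ)) *ᵥ a)
          (((k.1.2 : Matrix Q Q ℂ) ⊗ₖ (k.2.2 : Matrix S S ℂ)) *ᵥ b))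
        (Sum.elim ((((k.1.1 : Matrix P P ℂ) ⊗ₖ (k.2.2 : Matrix S S ℂ)).map star) *ᵥ c)
          ((((k.1.2 : Matrix Q Q ℂ) ⊗ₖ (k.2.1 : Matrix R R ℂ)).map star) *ᵥ d))) := by
  rw [unitaryOpPi_degOne, dualPairι_map_star_mulVec]

/-- The block embedding `V⁺⊗W⁺ ↪ 𝕎`: `a ↦ a ⊕ 0 ⊕ 0 ⊕ 0`. [folklore] -/
def embPR : (P × R → ℂ) →ₗ[ℂ] (DPIdx P Q R S → ℂ) where
  toFun a := Sum.elim (Sum.elim a 0) 0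
  map_add' a b := by
    funext x; rcases x with ((_ | _) | (_ | _)) <;> simp
  map_smul' r a := by
    funext x; rcases x with ((_ | _) | (_ | _)) <;> simp

omit [Fintype P] [DecidableEq P] [Fintype Q] [DecidableEq Q] [Fintype R] [DecidableEq R] [Fintype S] [DecidableEq S] in
/-- Unfolding. [folklore] -/
theorem embPR_apply (a : P × R → ℂ) : (embPR a : DPIdx P Q R S → ℂ) = Sum.elim (Sum.elim a 0) 0 := rfl

/-- **The holomorphic degree-`(1,0)` family** `degOnePR : (P × R → ℂ) →ₗ[ℂ] 𝓢(ℝ^{DPIdx})`, `a ↦ Σ_{(p,r)} a_{pr} h_{e_{pr}}`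
(the linear forms on the `V⁺ ⊗ W⁺` block times the Gaussian). [cite: Folland1989, Prop (4.39)] -/
def degOnePR : (P × R → ℂ) →ₗ[ℂ] SD := degOne ∘ₗ embPR

/-- Unfolding. [folklore] -/
theorem degOnePR_apply (a : P × R → ℂ) :
    (degOnePR a : SD) = degOne (Sum.elim (Sum.elim a (0 : Q × S → ℂ)) (0 : (P × S) ⊕ (Q × R) → ℂ)) := rfl

/-- `degOnePR` is injective. [folklore] -/
theorem degOnePR_injective : Function.Injective (degOnePR (P := P) (Q := Q) (R := R) (S := S)) := by
  intro a b h
  have h1 := degOne_injective h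
  funext pr
  have h2 := congr_fun h1 (Sum.inl (Sum.inl pr))
  simp only [embPR_apply, Sum.elim_inl] at h2
  exact h2

/-- **`K × K′` on the holomorphic degree-`(1,0)` family**: `μ₀(dualPairι ((A,B),(C,D))) (degOnePR a) = degOnePR ((A ⊗ₖ C) a)`
— the type `std_P ⊠ std_R` (trivial on `U(Q) × U(S)`). [cite: Folland1989, Prop (4.39)] -/
theorem unitaryOpPi_dualPairι_degOnePR (k : DPK P Q R S) (a : P × R → ℂ) :
    unitaryOpPi (dualPairι k) (degOnePR a : SD) =
      degOnePR (((k.1.1 : Matrix P P ℂ) ⊗ₖ (k.2.1 : Matrix R R ℂ)) *ᵥ a) := by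
  have h0 : (0 : (P × S) ⊕ (Q × R) → ℂ) = Sum.elim (0 : P × S → ℂ) (0 : Q × R → ℂ) := by
    funext x; rcases x with (_ | _) <;> rfl
  rw [degOnePR_apply, degOnePR_apply, h0, unitaryOpPi_dualPairι_degOne]
  simp only [Matrix.mulVec_zero]

end DualPair

/-! ## §4  Rank-one second member (`R = Unit`): the family `degOneP : (P → ℂ) →ₗ 𝓢` of type `C • (A a)` -/

section RankOne

variable {P Q S : Type*} [Fintype P] [DecidableEq P] [Fintype Q] [DecidableEq Q] [Fintype S] [DecidableEq S]

local notation "SD₁" => SchwartzMap (DPIdx P Q Unit S → ℝ) ℂ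

/-- `V⁺ ≅ V⁺ ⊗ W⁺` for `dim W⁺ = 1`: `a ↦ ((p, ⋆) ↦ a p)`. [folklore] -/
def curryUnit : (P → ℂ) →ₗ[ℂ] (P × Unit → ℂ) where
  toFun a := fun pr => a pr.1
  map_add' _ _ := rfl
  map_smul' _ _ := rfl

omit [Fintype P] [DecidableEq P] in
/-- Unfolding. [folklore] -/
theorem curryUnit_apply (a : P → ℂ) (pr : P × Unit) : curryUnit a pr = a pr.1 := rfl

omit [DecidableEq P] in
/-- `(A ⊗ₖ C) (a ∘ fst) = (C • A a) ∘ fst` for `C ∈ U(1) = U(Unit)`. [folklore] -/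
theorem kronecker_mulVec_curryUnit (A : Matrix P P ℂ) (C : Matrix Unit Unit ℂ) (a : P → ℂ) :
    (A ⊗ₖ C) *ᵥ curryUnit a = curryUnit (C () () • (A *ᵥ a)) := by
  funext ⟨p, u⟩
  rcases u with ⟨⟩
  rw [curryUnit_apply, Matrix.mulVec, dotProduct, Fintype.sum_prod_type, Pi.smul_apply, smul_eq_mul, Matrix.mulVec,
    dotProduct, Finset.mul_sum]
  refine Finset.sum_congr rfl fun q _ => ?_
  rw [Fintype.sum_unique, Matrix.kroneckerMap_apply, curryUnit_apply]
  change A p q * C () () * a q = C () () * (A p q * a q)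
  ring

/-- **The holomorphic degree-one family for a rank-one second member**: `degOneP : (P → ℂ) →ₗ[ℂ] 𝓢(ℝ^{DPIdx P Q 1 S})`,
`a ↦ Σ_p a_p h_{e_{(p,⋆)}}`. [cite: Folland1989, Prop (4.39)] -/
def degOneP : (P → ℂ) →ₗ[ℂ] SD₁ := degOnePR ∘ₗ curryUnit

/-- Unfolding. [folklore] -/
theorem degOneP_apply (a : P → ℂ) : (degOneP a : SD₁) = degOnePR (curryUnit a) := rfl

/-- `degOneP` is injective. [folklore] -/
theorem degOneP_injective : Function.Injective (degOneP (P := P) (Q := Q) (S := S)) := by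
  intro a b h
  have h1 := degOnePR_injective h
  funext p
  exact congr_fun h1 (p, ())

/-- **`K × K′` on `degOneP`**: `μ₀(dualPairι ((A,B),(C,D))) (degOneP a) = degOneP (C • A a)` — the type `std_P ⊗ std_{U(1)}`,
trivial on `U(Q) × U(S)`. [cite: Folland1989, Prop (4.39)] -/
theorem unitaryOpPi_dualPairι_degOneP (k : DPK P Q Unit S) (a : P → ℂ) :
    unitaryOpPi (dualPairι k) (degOneP a : SD₁) =
      degOneP (((k.2.1 : Matrix Unit Unit ℂ) () ()) • ((k.1.1 : Matrix P P ℂ) *ᵥ a)) := by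
  rw [degOneP_apply, degOneP_apply, unitaryOpPi_dualPairι_degOnePR, kronecker_mulVec_curryUnit]

/-- The `K = U(P) × U(Q)`-part alone (`K′`-component trivial): `μ₀(dualPairι ((A,B),1)) (degOneP a) = degOneP (A a)` — the
STANDARD representation of `U(P)`, trivial on `U(Q)`. [cite: Folland1989, Prop (4.39)] -/
theorem unitaryOpPi_dualPairι_degOneP_fst (kV : Matrix.unitaryGroup P ℂ × Matrix.unitaryGroup Q ℂ) (a : P → ℂ) :
    unitaryOpPi (dualPairι ((kV, 1) : DPK P Q Unit S)) (degOneP a : SD₁) = degOneP ((kV.1 : Matrix P P ℂ) *ᵥ a) := by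
  rw [unitaryOpPi_dualPairι_degOneP]
  simp only [Prod.fst_one, OneMemClass.coe_one, Matrix.one_apply_eq, one_smul]

end RankOne

/-! ## §5  Any covariant realisation: the `K × K′`-type of the degree-one vectors -/

section Covariant

variable {P Q R S : Type*} [Fintype P] [DecidableEq P] [Fintype Q] [DecidableEq Q] [Fintype R] [DecidableEq R]
  [Fintype S] [DecidableEq S]

variable {ωS : DPK P Q R S → ((SchwartzMap (DPIdx P Q R S → ℝ) ℂ) →ₗ[ℂ] SchwartzMap (DPIdx P Q R S → ℝ) ℂ)}
  {ω : DPK P Q R S → ((Lp ℂ 2 (volume : Measure (DPIdx P Q R S → ℝ))) ≃ₗᵢ[ℂ]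
    Lp ℂ 2 (volume : Measure (DPIdx P Q R S → ℝ)))}

/-- **The degree-one `K × K′`-type of a covariant realisation**: if `ωS` is Heisenberg-covariant through `dualPairι` and
lifts to unitaries `ω`, then on the holomorphic degree-`(1,0)` family
`ωS k (degOnePR a) = vacCoeff ω k • degOnePR ((A ⊗ₖ C) a)`. [cite: Folland1989, Prop (4.39)] -/
theorem IsRhoCovariantS.apply_degOnePR_dualPair
    (hS : IsRhoCovariantS (fun k : DPK P Q R S => dualPairι k) ωS) (hlift : ∀ k, LiftsTo (ωS k) (liftCLM ω k))
    (k : DPK P Q R S) (a : P × R → ℂ) :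
    ωS k (degOnePR a) = vacCoeff ω k • degOnePR (((k.1.1 : Matrix P P ℂ) ⊗ₖ (k.2.1 : Matrix R R ℂ)) *ᵥ a) := by
  rw [hS.apply_eq_vacCoeff_smul_unitaryOpPi hlift, unitaryOpPi_dualPairι_degOnePR]

/-- The four blocks at once. [cite: Folland1989, Prop (4.39)] -/
theorem IsRhoCovariantS.apply_degOne_dualPair
    (hS : IsRhoCovariantS (fun k : DPK P Q R S => dualPairι k) ωS) (hlift : ∀ k, LiftsTo (ωS k) (liftCLM ω k))
    (k : DPK P Q R S) (a : P × R → ℂ) (b : Q × S → ℂ) (c : P × S → ℂ) (d : Q × R → ℂ) :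
    ωS k (degOne (Sum.elim (Sum.elim a b) (Sum.elim c d))) =
      vacCoeff ω k • degOne (Sum.elim
        (Sum.elim (((k.1.1 : Matrix P P ℂ) ⊗ₖ (k.2.1 : Matrix R R ℂ)) *ᵥ a)
          (((k.1.2 : Matrix Q Q ℂ) ⊗ₖ (k.2.2 : Matrix S S ℂ)) *ᵥ b))
        (Sum.elim ((((k.1.1 : Matrix P P ℂ) ⊗ₖ (k.2.2 : Matrix S S ℂ)).map star) *ᵥ c)
          ((((k.1.2 : Matrix Q Q ℂ) ⊗ₖ (k.2.1 : Matrix R R ℂ)).map star) *ᵥ d))) := by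
  rw [hS.apply_eq_vacCoeff_smul_unitaryOpPi hlift, unitaryOpPi_dualPairι_degOne]

/-- **The constructed compact Weil representation** `dualPairWeilRep χ` (`= χ k • μ₀(dualPairι k)`) on the holomorphic
degree-`(1,0)` family: `χ k • degOnePR ((A ⊗ₖ C) a)`. [cite: Folland1989, Prop (4.39)] -/
theorem dualPairWeilRep_degOnePR (χ : DPK P Q R S →* Circle) (k : DPK P Q R S) (a : P × R → ℂ) :
    dualPairWeilRep χ k (degOnePR a) =
      ((χ k : Circle) : ℂ) • degOnePR (((k.1.1 : Matrix P P ℂ) ⊗ₖ (k.2.1 : Matrix R R ℂ)) *ᵥ a) := by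
  rw [dualPairWeilRep_apply, unitaryOpPi_dualPairι_degOnePR]

end Covariant

end Literature.Analysis.SegalBargmann
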